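import Summits.BirchSwinnertonDyer.BirchSwinnertonDyer.Theorems.AdditiveBranchIMCGordTwoRankZeroDesc3DoorOfLower
import Summits.BirchSwinnertonDyer.BirchSwinnertonDyer.Theorems.KatoDescentPotSupersingularWildLowerDesc3RecordsX4deep01
import Summits.BirchSwinnertonDyer.BirchSwinnertonDyer.Theorems.KatoDescentPotSupersingularWildLowerDesc3RecordsX4deep02
import Summits.BirchSwinnertonDyer.Rank1Residual.GaloisImage.FrobeniusOrderWitness
import Summits.BirchSwinnertonDyer.Rank1Residual.Supersingular.CountPointsFast
import Summits.BirchSwinnertonDyer.Rank1Residual.X11b.KrausMinimalityGeneralTwo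
import Summits.BirchSwinnertonDyer.Rank1Residual.Additive.X4ThreeResCertKernel
import Literature.NumberTheory.EllipticCurves.IsogenyIdProofs
import HarnessLib

/-!
# Route `AdditiveBranchIMC` (rung K1), crux `GordTwoRankZeroOffCaseOne` (item 19357, odd child 19245 ∋ `p = 3`) — DEEP RECORDS part 2 of 3 (classes `386019q1`, `402624cj1`, `413559be1`, `422253b1`): wild X4 rank-`0`
# classes with `#Ш_an = 81` closed PER CLASS: bsd-potss K9's second-`3`-descent LOWER records `K9Desc3.lower3_deep_<label>` ∘ the X4♯(3) UPPER half
# (cell `bsd-addord`, seat `bsd-addord-k1-c2` gen 8; classes 98280o 105408k 280962ce 328320de 386019q 402624cj 413559be 422253b 440775g 446904j 496584bv)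

HONEST FRAMING: nothing here proves BSD or the crux (OPEN at class level); THEOREMS ONLY (no definition, no named fact, no `sorry`); per pair /
per class; NOT a class theorem; nothing booked (booking is referee A's on the planner's offer). These are bsd-potss's «ONLY per-pair-open classes of
the K9 intrinsic census» (k9-desc3 g0, 2026-08-26T18:36Z): wild at `3` (`27 ∣ N`), `ρ̄_{E,3}` onto, `r_an = 0`, single-member, `#Ш_an = 81`. Their
LOWER half `ord₃ #Ш_an ≤ ord₃ #Ш` (`81 ∣ #Ш`) is the K9 kernel record `K9Desc3.lower3_deep_<label>`
(`Theorems/KatoDescentPotSupersingularWildLowerDesc3RecordsX4deep01–03`, seat bsd-potss-k9-desc3; displayed inputs: a DEEP WITNESS `x, y ∈ Ш(E)`,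
`ord x = 9`, `3y = 0`, `y ∉ ℤx` — EVIDENCE = their cc-eng-4 B-1 second `3`-descent (Creutz 2014 Thm. 7.2) runs kit j257505 / j257911 / j257912 /
j258132 / j258551, NONEMPTY(witness) on two engines with XVERIFY:PASS, quoted in their docstrings — plus Cassels–Tate `hCT`, Cassels `hCassels`, GZK,
modularity). The UPPER half `ord₃ #Ш ≤ ord₃ #Ш_an` is Kato 2004 Thm. 14.5 (3) in the Manin-free SHARP reading A161′ on the potentially good branch
(all 11 are wild ⟹ `ord₃ j ≥ 0`): team n1011's `X4RankZero.missingUpperBoundAt_three_of_cert_maninFree_noL20` on the 10 classes with `3 ∤ ∏ c_ℓ`,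
and this seat's `missingUpperBoundAt_three_of_x4Cert_tamLocal` (p529837; Kodaira IV* with `c₃ = 3 = ∏ c_ℓ`) on `422253b`. IN THE KERNEL per record:
`Δ ≠ 0` and global minimality of the Cremona model (Kraus, support of `Δ` listed), `ρ̄_{E,3}` ONTO (Frobenius witnesses `ℓ₁` = irreducible
characteristic polynomial mod `3`, `ℓ₂ ≡ 1`, `a_{ℓ₂} ≡ 2 (mod 3)`, `9 ∤ #Ẽ(𝔽_{ℓ₂})`; point counts by `decide +kernel`), `Addv W 3`, and the `3`-adic
image certificate = a `j`-WITNESS `q ≠ 3` with `ord_q j = 3·v_q(c₄) − v_q(Δ) < 0`, `3 ∤ ord_q j` from divisibility certificates on the integral model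
(`jWitness_three_of_intModel`, file `…Desc3DoorOfLower`). DISPLAYED binders: the register facts {hKato = A161′, hDel, hGZK, hmod, hmodD, hKatoω, hCT, hCassels},
Cremona's `r_an = 0` and `#Ш_an = s` with `ord₃ s ≤ 4` (`hr`, `hs`, `hv`; value quoted per record), K9's deep witness (`hx`, `h3y`, `hy`), and the
Tamagawa datum (`htam : 3 ∤ ∏ c_ℓ`, resp. `ord₃ ∏ c_ℓ = v₃(c₃)` for `422253b`; Cremona `allbsd` ∏c ∥ Tate's algorithm, quoted per record).
References: [Kato2004Asterisque] Thm. 14.5 (3) (p. 236), Thm. 17.4 (3) (p. 273); [Delbourgo1998] Prop. 4 (p. 144); [Creutz2014] Thm. 7.2;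
[Wuthrich2014] Lemma 20 (p. 399); [Serre1972] §2; [SilvermanAEC2009] Thm. X.4.14, VII.1 Rem. 1.1; [Kraus1989]; [MilneADT2006] Thm. I.7.3;
[Miller2011LMS] Def. 1.1; [Cremona2006] Table 1.
-/

set_option autoImplicit false

noncomputable section

open scoped Classical

open WeierstrassCurve Literature.NumberTheory.EllipticCurves
  Literature.NumberTheory.EllipticCurves.Rank1Residual
  Literature.NumberTheory.EllipticCurves.Rank1Residual.Typed
  Literature.NumberTheory.EllipticCurves.Rank1Residual.X11RankOneCertificates
  Literature.NumberTheory.EllipticCurves.ModularForms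
  Literature.NumberTheory.GaloisRepresentations
  Summit.BirchSwinnertonDyer.BirchSwinnertonDyer.Rank1Residual.IntModel
  Summit.BirchSwinnertonDyer.Rank1Residual.X11b
  Summit.BirchSwinnertonDyer.Rank1Residual.GaloisImage
  Summit.BirchSwinnertonDyer.Rank1Residual.Supersingular

set_option linter.dupNamespace false

namespace Summit.BirchSwinnertonDyer.BirchSwinnertonDyer.Theorems.AdditiveBranchIMCGordTwoRankZeroDesc3

open Summit.BirchSwinnertonDyer.Rank1Residual
open Summit.BirchSwinnertonDyer.Rank1Residual.Additive
open Summit.BirchSwinnertonDyer.BirchSwinnertonDyer.Theorems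

/-! ### `386019q1` (class `386019q`, single member; `N = 386019 = 3³·17·29²`; Cremona: `r_an = 0`, `#Ш_an = 81`, `#tors = 1`, `∏ c_ℓ = 1`; Kodaira at `3`: II, `c₃ = 1`, `f₃ = 3`) -/

/-- `[0, 0, 1, -32799, -2286469]` (Cremona's minimal model of `386019q1`) is an elliptic curve: `Δ ≠ 0` (support `[[3, 3, 3], [17, 1, 1], [29, 2, 6]]` as `(q, v_q N, v_q Δ)`). [cite: Cremona2006, Table 1] -/
theorem isElliptic_w386019q1 : (⟨0, 0, 1, -32799, -2286469⟩ : WeierstrassCurve ℚ).IsElliptic :=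
  X11b.isElliptic_of_discOf_ne_zero 0 0 1 (-32799) (-2286469) (by decide +kernel)

/-- `[0, 0, 1, -32799, -2286469]` (`386019q1`) is globally minimal: support of `Δ` = `[[3, 3, 3], [17, 1, 1], [29, 2, 6]]` as `(q, v_q N, v_q Δ)`, Kraus prime by prime (kernel). [cite: SilvermanAEC2009, VII.1 Remark 1.1] [cite: Kraus1989, Prop. 1 and Prop. 2] -/
theorem isGloballyMinimal_w386019q1 : (⟨0, 0, 1, -32799, -2286469⟩ : WeierstrassCurve ℚ).IsGloballyMinimal :=
  X11b.isGloballyMinimal_of_krausCriterion_support 0 0 1 (-32799) (-2286469)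
    [(3, 3, 3), (17, 1, 1), (29, 2, 6)]
    (by intro t ht; simp only [List.mem_cons, List.not_mem_nil, or_false] at ht; rcases ht with rfl | rfl | rfl <;> norm_num)
    (by decide +kernel) (by decide +kernel)

/-- **`ρ̄_{E,3}` ONTO for `E = 386019q1`** (kernel): irreducible by `ℓ₁ = 5` (`#Ẽ(𝔽_{5}) = 4`, `X² − 2X + ℓ₁` has no root mod 3); order-3 element by
`ℓ₂ = 31` (`#Ẽ(𝔽_{31}) = 30`, `ℓ₂ ≡ 1`, `a = 2 ≡ 2 (mod 3)`, `9 ∤ #Ẽ`) — `hasSurjectiveModNGaloisRep_of_intModel_of_irr_of_order`. [cite: Serre1972, §2.4 Prop. 15, §2.8 Prop. 19] -/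
theorem surj_w386019q1_3 : (⟨0, 0, 1, -32799, -2286469⟩ : WeierstrassCurve ℚ).HasSurjectiveModNGaloisRep 3 := by
  haveI := isElliptic_w386019q1
  haveI := isGloballyMinimal_w386019q1
  haveI : Fact (Nat.Prime 5) := ⟨by norm_num⟩
  haveI : Fact (Nat.Prime 31) := ⟨by norm_num⟩
  have hI : integralModelInt (⟨0, 0, 1, -32799, -2286469⟩ : WeierstrassCurve ℚ) = (⟨0, 0, 1, -32799, -2286469⟩ : WeierstrassCurve ℤ) :=
    integralModelInt_eq_of_map_eq _ (map_mk_int 0 0 1 (-32799) (-2286469))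
  have hc₁ : Nat.card ((((⟨0, 0, 1, -32799, -2286469⟩ : WeierstrassCurve ℤ)).map (Int.castRingHom (ZMod 5))).toAffine.Point) = 4 := by
    have h := natCard_point_eq_countPoints 0 0 1 (-32799) (-2286469) 5 (by norm_num) (by decide +kernel)
    have h' : countPoints [0, 0, 1, -32799, -2286469] 5 = 4 := countPoints_eq_of_fast (by decide +kernel)
    exact_mod_cast h.trans h'
  have hc₂ : Nat.card ((((⟨0, 0, 1, -32799, -2286469⟩ : WeierstrassCurve ℤ)).map (Int.castRingHom (ZMod 31))).toAffine.Point) = 30 := by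
    have h := natCard_point_eq_countPoints 0 0 1 (-32799) (-2286469) 31 (by norm_num) (by decide +kernel)
    have h' : countPoints [0, 0, 1, -32799, -2286469] 31 = 30 := countPoints_eq_of_fast (by decide +kernel)
    exact_mod_cast h.trans h'
  exact hasSurjectiveModNGaloisRep_of_intModel_of_irr_of_order hI 3 5 31 (by norm_num) (by norm_num) (by decide +kernel)
    (by decide +kernel) hc₁ hc₂ (by decide) (by decide) (by decide) (by decide)

/-- **`BSD(E,3)` for the DEEP class `E = 386019q1`** (`#Ш_an = 81`): LOWER half = bsd-potss K9's second-descent record `K9Desc3.lower3_deep_386019q1` (deep witness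
`x, y ∈ Ш(E)`, `ord x = 9`, `3y = 0`, `y ∉ ℤx` ⟹ `81 ∣ #Ш`; evidence quoted THERE: cc-eng-4 B-1 second `3`-descent, two engines, XVERIFY:PASS) with `W₀ := W`;
UPPER half = team n1011's `X4RankZero.missingUpperBoundAt_three_of_cert_maninFree_noL20` (Kato 14.5 (3), A161′) — `ρ̄_{E,3}` onto, `Addv W 3`, irreducibility and the `j`-witness
`q = 17` (`v_q(c₄) = 0`, `v_q(Δ) = 1`, `ord_q j = -1`) IN THE KERNEL; displayed: register facts, `hr`/`hs`/`hv` (`#Ш_an = 81`, `ord₃ = 4`), K9's deep witness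
`hx`/`h3y`/`hy`, `htam : 3 ∤ ∏ c_ℓ` (DATA: Cremona `∏ c_ℓ = 1`). Per class (single member); nothing booked. [cite: Kato2004Asterisque, Thm. 14.5 (3) (p. 236), Thm. 17.4 (3) (p. 273)] [cite: Delbourgo1998, Prop. 4 (p. 144)] [cite: Creutz2014, Thm. 7.2] [cite: SilvermanAEC2009, Thm. X.4.14 and VII.1 Remark 1.1] [cite: Miller2011LMS, §1 and Def. 1.1] -/
theorem bsdp3_deep_386019q1
    (hKato : Kato2004.rankZero_padicValNat_sha_le_sub_localTamagawa_of_additive_potGood_of_imageContainsSL2_maninFree)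
    (hDel : Delbourgo1998.prop4_rankZero_pow_dvd_constantCoeff)
    (hGZK : rank_eq_analyticRank_of_analyticRank_le_one) (hmod : hasEntireLFunction_rat)
    (hmodD : nonempty_modularParametrizationData)
    (hKatoω : Wuthrich2014.kato_minusEigenCharIdeal_dvd_cyclotomicThree_of_surjective)
    (hCT : exists_casselsTate_pairing (K := ℚ)) (hCassels : bsdRHS_eq_of_isIsogenous)
    {W : WeierstrassCurve ℚ} [W.IsElliptic] [W.IsGloballyMinimal] (hWeq : W = ⟨0, 0, 1, -32799, -2286469⟩)
    (hr : W.analyticRank = 0) {s : ℚ} (hs : shaAn W = (s : ℂ)) (hv : padicValRat 3 s ≤ 4)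
    {x y : W.sha} (hx : addOrderOf x = 3 ^ 2) (h3y : 3 • y = 0) (hy : y ∉ AddSubgroup.zmultiples x)
    (htam : ¬ 3 ∣ W.tamagawaProduct) :
    BSDp W 3 := by
  haveI : Fact (Nat.Prime 3) := ⟨Nat.prime_three⟩
  haveI : Fact (Nat.Prime 17) := ⟨by norm_num⟩
  have hsurj : Surj W 3 := by rw [hWeq]; exact surj_w386019q1_3
  have hIW : integralModelInt W = (⟨0, 0, 1, -32799, -2286469⟩ : WeierstrassCurve ℤ) :=
    integralModelInt_eq_of_map_eq _ (by rw [hWeq]; ext <;> simp [WeierstrassCurve.map])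
  have hadd : Addv W 3 := Additive.addv_of_intModel hIW 3 (by decide +kernel) (by decide +kernel)
  have hX : ClassX4 W 3 := ⟨by norm_num, hadd, hasIrreducibleModPGaloisRep_of_hasSurjectiveModNGaloisRep W 3 hsurj⟩
  have hcert : padicValRat 3 W.j < 0 ∨
      (∃ q : ℕ, q.Prime ∧ q ≠ 3 ∧ padicValRat q W.j < 0 ∧ ¬ (3 : ℤ) ∣ padicValRat q W.j) ∨
        W.HasSurjectiveModNGaloisRep 9 :=
    Or.inr (Or.inl (jWitness_three_of_intModel hIW 17 (by norm_num) 0 1 (by decide +kernel) (by decide +kernel)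
      (by decide +kernel) (by decide +kernel) (by norm_num) (by norm_num)))
  have hlow : MissingLowerBoundAt W 3 :=
    K9Desc3.lower3_deep_386019q1 hCT hCassels hGZK hmod W hWeq hr hs hv hx h3y hy W (WeierstrassCurve.isIsogenous_self W)
  exact bsdp_of_missingPPartAt W 3 hGZK (by rw [hr]; exact zero_le_one)
    (missingPPartAt_of_lower_of_upper W 3 hlow
      (X4RankZero.missingUpperBoundAt_three_of_cert_maninFree_noL20 W hKato hDel hGZK hmod hmodD hKatoω hr hX hsurj hcert htam))

/-! ### `402624cj1` (class `402624cj`, single member; `N = 402624 = 2⁶·3³·233`; Cremona: `r_an = 0`, `#Ш_an = 81`, `#tors = 1`, `∏ c_ℓ = 4`; Kodaira at `3`: II, `c₃ = 1`, `f₃ = 3`) -/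

/-- `[0, 0, 0, -47825196, -127301421008]` (Cremona's minimal model of `402624cj1`) is an elliptic curve: `Δ ≠ 0` (support `[[2, 6, 31], [3, 3, 3], [233, 1, 2]]` as `(q, v_q N, v_q Δ)`). [cite: Cremona2006, Table 1] -/
theorem isElliptic_w402624cj1 : (⟨0, 0, 0, -47825196, -127301421008⟩ : WeierstrassCurve ℚ).IsElliptic :=
  X11b.isElliptic_of_discOf_ne_zero 0 0 0 (-47825196) (-127301421008) (by decide +kernel)

/-- `[0, 0, 0, -47825196, -127301421008]` (`402624cj1`) is globally minimal: support of `Δ` = `[[2, 6, 31], [3, 3, 3], [233, 1, 2]]` as `(q, v_q N, v_q Δ)`, Kraus prime by prime (kernel). [cite: SilvermanAEC2009, VII.1 Remark 1.1] [cite: Kraus1989, Prop. 1 and Prop. 2] -/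
theorem isGloballyMinimal_w402624cj1 : (⟨0, 0, 0, -47825196, -127301421008⟩ : WeierstrassCurve ℚ).IsGloballyMinimal :=
  X11b.isGloballyMinimal_of_krausCriterion_support 0 0 0 (-47825196) (-127301421008)
    [(2, 6, 31), (3, 3, 3), (233, 1, 2)]
    (by intro t ht; simp only [List.mem_cons, List.not_mem_nil, or_false] at ht; rcases ht with rfl | rfl | rfl <;> norm_num)
    (by decide +kernel) (by decide +kernel)

/-- **`ρ̄_{E,3}` ONTO for `E = 402624cj1`** (kernel): irreducible by `ℓ₁ = 7` (`#Ẽ(𝔽_{7}) = 5`, `X² − 3X + ℓ₁` has no root mod 3); order-3 element by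
`ℓ₂ = 61` (`#Ẽ(𝔽_{61}) = 48`, `ℓ₂ ≡ 1`, `a = 14 ≡ 2 (mod 3)`, `9 ∤ #Ẽ`) — `hasSurjectiveModNGaloisRep_of_intModel_of_irr_of_order`. [cite: Serre1972, §2.4 Prop. 15, §2.8 Prop. 19] -/
theorem surj_w402624cj1_3 : (⟨0, 0, 0, -47825196, -127301421008⟩ : WeierstrassCurve ℚ).HasSurjectiveModNGaloisRep 3 := by
  haveI := isElliptic_w402624cj1
  haveI := isGloballyMinimal_w402624cj1
  haveI : Fact (Nat.Prime 7) := ⟨by norm_num⟩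
  haveI : Fact (Nat.Prime 61) := ⟨by norm_num⟩
  have hI : integralModelInt (⟨0, 0, 0, -47825196, -127301421008⟩ : WeierstrassCurve ℚ) = (⟨0, 0, 0, -47825196, -127301421008⟩ : WeierstrassCurve ℤ) :=
    integralModelInt_eq_of_map_eq _ (map_mk_int 0 0 0 (-47825196) (-127301421008))
  have hc₁ : Nat.card ((((⟨0, 0, 0, -47825196, -127301421008⟩ : WeierstrassCurve ℤ)).map (Int.castRingHom (ZMod 7))).toAffine.Point) = 5 := by
    have h := natCard_point_eq_countPoints 0 0 0 (-47825196) (-127301421008) 7 (by norm_num) (by decide +kernel)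
    have h' : countPoints [0, 0, 0, -47825196, -127301421008] 7 = 5 := countPoints_eq_of_fast (by decide +kernel)
    exact_mod_cast h.trans h'
  have hc₂ : Nat.card ((((⟨0, 0, 0, -47825196, -127301421008⟩ : WeierstrassCurve ℤ)).map (Int.castRingHom (ZMod 61))).toAffine.Point) = 48 := by
    have h := natCard_point_eq_countPoints 0 0 0 (-47825196) (-127301421008) 61 (by norm_num) (by decide +kernel)
    have h' : countPoints [0, 0, 0, -47825196, -127301421008] 61 = 48 := countPoints_eq_of_fast (by decide +kernel)
    exact_mod_cast h.trans h'
  exact hasSurjectiveModNGaloisRep_of_intModel_of_irr_of_order hI 3 7 61 (by norm_num) (by norm_num) (by decide +kernel)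
    (by decide +kernel) hc₁ hc₂ (by decide) (by decide) (by decide) (by decide)

/-- **`BSD(E,3)` for the DEEP class `E = 402624cj1`** (`#Ш_an = 81`): LOWER half = bsd-potss K9's second-descent record `K9Desc3.lower3_deep_402624cj1` (deep witness
`x, y ∈ Ш(E)`, `ord x = 9`, `3y = 0`, `y ∉ ℤx` ⟹ `81 ∣ #Ш`; evidence quoted THERE: cc-eng-4 B-1 second `3`-descent, two engines, XVERIFY:PASS) with `W₀ := W`;
UPPER half = team n1011's `X4RankZero.missingUpperBoundAt_three_of_cert_maninFree_noL20` (Kato 14.5 (3), A161′) — `ρ̄_{E,3}` onto, `Addv W 3`, irreducibility and the `j`-witness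
`q = 233` (`v_q(c₄) = 0`, `v_q(Δ) = 2`, `ord_q j = -2`) IN THE KERNEL; displayed: register facts, `hr`/`hs`/`hv` (`#Ш_an = 81`, `ord₃ = 4`), K9's deep witness
`hx`/`h3y`/`hy`, `htam : 3 ∤ ∏ c_ℓ` (DATA: Cremona `∏ c_ℓ = 4`). Per class (single member); nothing booked. [cite: Kato2004Asterisque, Thm. 14.5 (3) (p. 236), Thm. 17.4 (3) (p. 273)] [cite: Delbourgo1998, Prop. 4 (p. 144)] [cite: Creutz2014, Thm. 7.2] [cite: SilvermanAEC2009, Thm. X.4.14 and VII.1 Remark 1.1] [cite: Miller2011LMS, §1 and Def. 1.1] -/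
theorem bsdp3_deep_402624cj1
    (hKato : Kato2004.rankZero_padicValNat_sha_le_sub_localTamagawa_of_additive_potGood_of_imageContainsSL2_maninFree)
    (hDel : Delbourgo1998.prop4_rankZero_pow_dvd_constantCoeff)
    (hGZK : rank_eq_analyticRank_of_analyticRank_le_one) (hmod : hasEntireLFunction_rat)
    (hmodD : nonempty_modularParametrizationData)
    (hKatoω : Wuthrich2014.kato_minusEigenCharIdeal_dvd_cyclotomicThree_of_surjective)
    (hCT : exists_casselsTate_pairing (K := ℚ)) (hCassels : bsdRHS_eq_of_isIsogenous)
    {W : WeierstrassCurve ℚ} [W.IsElliptic] [W.IsGloballyMinimal] (hWeq : W = ⟨0, 0, 0, -47825196, -127301421008⟩)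
    (hr : W.analyticRank = 0) {s : ℚ} (hs : shaAn W = (s : ℂ)) (hv : padicValRat 3 s ≤ 4)
    {x y : W.sha} (hx : addOrderOf x = 3 ^ 2) (h3y : 3 • y = 0) (hy : y ∉ AddSubgroup.zmultiples x)
    (htam : ¬ 3 ∣ W.tamagawaProduct) :
    BSDp W 3 := by
  haveI : Fact (Nat.Prime 3) := ⟨Nat.prime_three⟩
  haveI : Fact (Nat.Prime 233) := ⟨by norm_num⟩
  have hsurj : Surj W 3 := by rw [hWeq]; exact surj_w402624cj1_3
  have hIW : integralModelInt W = (⟨0, 0, 0, -47825196, -127301421008⟩ : WeierstrassCurve ℤ) :=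
    integralModelInt_eq_of_map_eq _ (by rw [hWeq]; ext <;> simp [WeierstrassCurve.map])
  have hadd : Addv W 3 := Additive.addv_of_intModel hIW 3 (by decide +kernel) (by decide +kernel)
  have hX : ClassX4 W 3 := ⟨by norm_num, hadd, hasIrreducibleModPGaloisRep_of_hasSurjectiveModNGaloisRep W 3 hsurj⟩
  have hcert : padicValRat 3 W.j < 0 ∨
      (∃ q : ℕ, q.Prime ∧ q ≠ 3 ∧ padicValRat q W.j < 0 ∧ ¬ (3 : ℤ) ∣ padicValRat q W.j) ∨
        W.HasSurjectiveModNGaloisRep 9 :=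
    Or.inr (Or.inl (jWitness_three_of_intModel hIW 233 (by norm_num) 0 2 (by decide +kernel) (by decide +kernel)
      (by decide +kernel) (by decide +kernel) (by norm_num) (by norm_num)))
  have hlow : MissingLowerBoundAt W 3 :=
    K9Desc3.lower3_deep_402624cj1 hCT hCassels hGZK hmod W hWeq hr hs hv hx h3y hy W (WeierstrassCurve.isIsogenous_self W)
  exact bsdp_of_missingPPartAt W 3 hGZK (by rw [hr]; exact zero_le_one)
    (missingPPartAt_of_lower_of_upper W 3 hlow
      (X4RankZero.missingUpperBoundAt_three_of_cert_maninFree_noL20 W hKato hDel hGZK hmod hmodD hKatoω hr hX hsurj hcert htam))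

/-! ### `413559be1` (class `413559be`, single member; `N = 413559 = 3³·17²·53`; Cremona: `r_an = 0`, `#Ш_an = 81`, `#tors = 1`, `∏ c_ℓ = 1`; Kodaira at `3`: II, `c₃ = 1`, `f₃ = 3`) -/

/-- `[1, -1, 0, -266223, -52867488]` (Cremona's minimal model of `413559be1`) is an elliptic curve: `Δ ≠ 0` (support `[[3, 3, 3], [17, 2, 10], [53, 1, 1]]` as `(q, v_q N, v_q Δ)`). [cite: Cremona2006, Table 1] -/
theorem isElliptic_w413559be1 : (⟨1, -1, 0, -266223, -52867488⟩ : WeierstrassCurve ℚ).IsElliptic :=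
  X11b.isElliptic_of_discOf_ne_zero 1 (-1) 0 (-266223) (-52867488) (by decide +kernel)

/-- `[1, -1, 0, -266223, -52867488]` (`413559be1`) is globally minimal: support of `Δ` = `[[3, 3, 3], [17, 2, 10], [53, 1, 1]]` as `(q, v_q N, v_q Δ)`, Kraus prime by prime (kernel). [cite: SilvermanAEC2009, VII.1 Remark 1.1] [cite: Kraus1989, Prop. 1 and Prop. 2] -/
theorem isGloballyMinimal_w413559be1 : (⟨1, -1, 0, -266223, -52867488⟩ : WeierstrassCurve ℚ).IsGloballyMinimal :=
  X11b.isGloballyMinimal_of_krausCriterion_support 1 (-1) 0 (-266223) (-52867488)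
    [(3, 3, 3), (17, 2, 10), (53, 1, 1)]
    (by intro t ht; simp only [List.mem_cons, List.not_mem_nil, or_false] at ht; rcases ht with rfl | rfl | rfl <;> norm_num)
    (by decide +kernel) (by decide +kernel)

/-- **`ρ̄_{E,3}` ONTO for `E = 413559be1`** (kernel): irreducible by `ℓ₁ = 19` (`#Ẽ(𝔽_{19}) = 14`, `X² − 6X + ℓ₁` has no root mod 3); order-3 element by
`ℓ₂ = 67` (`#Ẽ(𝔽_{67}) = 78`, `ℓ₂ ≡ 1`, `a = -10 ≡ 2 (mod 3)`, `9 ∤ #Ẽ`) — `hasSurjectiveModNGaloisRep_of_intModel_of_irr_of_order`. [cite: Serre1972, §2.4 Prop. 15, §2.8 Prop. 19] -/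
theorem surj_w413559be1_3 : (⟨1, -1, 0, -266223, -52867488⟩ : WeierstrassCurve ℚ).HasSurjectiveModNGaloisRep 3 := by
  haveI := isElliptic_w413559be1
  haveI := isGloballyMinimal_w413559be1
  haveI : Fact (Nat.Prime 19) := ⟨by norm_num⟩
  haveI : Fact (Nat.Prime 67) := ⟨by norm_num⟩
  have hI : integralModelInt (⟨1, -1, 0, -266223, -52867488⟩ : WeierstrassCurve ℚ) = (⟨1, -1, 0, -266223, -52867488⟩ : WeierstrassCurve ℤ) :=
    integralModelInt_eq_of_map_eq _ (map_mk_int 1 (-1) 0 (-266223) (-52867488))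
  have hc₁ : Nat.card ((((⟨1, -1, 0, -266223, -52867488⟩ : WeierstrassCurve ℤ)).map (Int.castRingHom (ZMod 19))).toAffine.Point) = 14 := by
    have h := natCard_point_eq_countPoints 1 (-1) 0 (-266223) (-52867488) 19 (by norm_num) (by decide +kernel)
    have h' : countPoints [1, -1, 0, -266223, -52867488] 19 = 14 := countPoints_eq_of_fast (by decide +kernel)
    exact_mod_cast h.trans h'
  have hc₂ : Nat.card ((((⟨1, -1, 0, -266223, -52867488⟩ : WeierstrassCurve ℤ)).map (Int.castRingHom (ZMod 67))).toAffine.Point) = 78 := by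
    have h := natCard_point_eq_countPoints 1 (-1) 0 (-266223) (-52867488) 67 (by norm_num) (by decide +kernel)
    have h' : countPoints [1, -1, 0, -266223, -52867488] 67 = 78 := countPoints_eq_of_fast (by decide +kernel)
    exact_mod_cast h.trans h'
  exact hasSurjectiveModNGaloisRep_of_intModel_of_irr_of_order hI 3 19 67 (by norm_num) (by norm_num) (by decide +kernel)
    (by decide +kernel) hc₁ hc₂ (by decide) (by decide) (by decide) (by decide)

/-- **`BSD(E,3)` for the DEEP class `E = 413559be1`** (`#Ш_an = 81`): LOWER half = bsd-potss K9's second-descent record `K9Desc3.lower3_deep_413559be1` (deep witness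
`x, y ∈ Ш(E)`, `ord x = 9`, `3y = 0`, `y ∉ ℤx` ⟹ `81 ∣ #Ш`; evidence quoted THERE: cc-eng-4 B-1 second `3`-descent, two engines, XVERIFY:PASS) with `W₀ := W`;
UPPER half = team n1011's `X4RankZero.missingUpperBoundAt_three_of_cert_maninFree_noL20` (Kato 14.5 (3), A161′) — `ρ̄_{E,3}` onto, `Addv W 3`, irreducibility and the `j`-witness
`q = 53` (`v_q(c₄) = 0`, `v_q(Δ) = 1`, `ord_q j = -1`) IN THE KERNEL; displayed: register facts, `hr`/`hs`/`hv` (`#Ш_an = 81`, `ord₃ = 4`), K9's deep witness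
`hx`/`h3y`/`hy`, `htam : 3 ∤ ∏ c_ℓ` (DATA: Cremona `∏ c_ℓ = 1`). Per class (single member); nothing booked. [cite: Kato2004Asterisque, Thm. 14.5 (3) (p. 236), Thm. 17.4 (3) (p. 273)] [cite: Delbourgo1998, Prop. 4 (p. 144)] [cite: Creutz2014, Thm. 7.2] [cite: SilvermanAEC2009, Thm. X.4.14 and VII.1 Remark 1.1] [cite: Miller2011LMS, §1 and Def. 1.1] -/
theorem bsdp3_deep_413559be1
    (hKato : Kato2004.rankZero_padicValNat_sha_le_sub_localTamagawa_of_additive_potGood_of_imageContainsSL2_maninFree)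
    (hDel : Delbourgo1998.prop4_rankZero_pow_dvd_constantCoeff)
    (hGZK : rank_eq_analyticRank_of_analyticRank_le_one) (hmod : hasEntireLFunction_rat)
    (hmodD : nonempty_modularParametrizationData)
    (hKatoω : Wuthrich2014.kato_minusEigenCharIdeal_dvd_cyclotomicThree_of_surjective)
    (hCT : exists_casselsTate_pairing (K := ℚ)) (hCassels : bsdRHS_eq_of_isIsogenous)
    {W : WeierstrassCurve ℚ} [W.IsElliptic] [W.IsGloballyMinimal] (hWeq : W = ⟨1, -1, 0, -266223, -52867488⟩)
    (hr : W.analyticRank = 0) {s : ℚ} (hs : shaAn W = (s : ℂ)) (hv : padicValRat 3 s ≤ 4)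
    {x y : W.sha} (hx : addOrderOf x = 3 ^ 2) (h3y : 3 • y = 0) (hy : y ∉ AddSubgroup.zmultiples x)
    (htam : ¬ 3 ∣ W.tamagawaProduct) :
    BSDp W 3 := by
  haveI : Fact (Nat.Prime 3) := ⟨Nat.prime_three⟩
  haveI : Fact (Nat.Prime 53) := ⟨by norm_num⟩
  have hsurj : Surj W 3 := by rw [hWeq]; exact surj_w413559be1_3
  have hIW : integralModelInt W = (⟨1, -1, 0, -266223, -52867488⟩ : WeierstrassCurve ℤ) :=
    integralModelInt_eq_of_map_eq _ (by rw [hWeq]; ext <;> simp [WeierstrassCurve.map])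
  have hadd : Addv W 3 := Additive.addv_of_intModel hIW 3 (by decide +kernel) (by decide +kernel)
  have hX : ClassX4 W 3 := ⟨by norm_num, hadd, hasIrreducibleModPGaloisRep_of_hasSurjectiveModNGaloisRep W 3 hsurj⟩
  have hcert : padicValRat 3 W.j < 0 ∨
      (∃ q : ℕ, q.Prime ∧ q ≠ 3 ∧ padicValRat q W.j < 0 ∧ ¬ (3 : ℤ) ∣ padicValRat q W.j) ∨
        W.HasSurjectiveModNGaloisRep 9 :=
    Or.inr (Or.inl (jWitness_three_of_intModel hIW 53 (by norm_num) 0 1 (by decide +kernel) (by decide +kernel)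
      (by decide +kernel) (by decide +kernel) (by norm_num) (by norm_num)))
  have hlow : MissingLowerBoundAt W 3 :=
    K9Desc3.lower3_deep_413559be1 hCT hCassels hGZK hmod W hWeq hr hs hv hx h3y hy W (WeierstrassCurve.isIsogenous_self W)
  exact bsdp_of_missingPPartAt W 3 hGZK (by rw [hr]; exact zero_le_one)
    (missingPPartAt_of_lower_of_upper W 3 hlow
      (X4RankZero.missingUpperBoundAt_three_of_cert_maninFree_noL20 W hKato hDel hGZK hmod hmodD hKatoω hr hX hsurj hcert htam))

/-! ### `422253b1` (class `422253b`, single member; `N = 422253 = 3⁴·13·401`; Cremona: `r_an = 0`, `#Ш_an = 81`, `#tors = 1`, `∏ c_ℓ = 3`; Kodaira at `3`: IV*, `c₃ = 3`, `f₃ = 4`) -/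

/-- `[1, -1, 0, -240106722, -1588926190123]` (Cremona's minimal model of `422253b1`) is an elliptic curve: `Δ ≠ 0` (support `[[3, 4, 10], [13, 1, 17], [401, 1, 1]]` as `(q, v_q N, v_q Δ)`). [cite: Cremona2006, Table 1] -/
theorem isElliptic_w422253b1 : (⟨1, -1, 0, -240106722, -1588926190123⟩ : WeierstrassCurve ℚ).IsElliptic :=
  X11b.isElliptic_of_discOf_ne_zero 1 (-1) 0 (-240106722) (-1588926190123) (by decide +kernel)

/-- `[1, -1, 0, -240106722, -1588926190123]` (`422253b1`) is globally minimal: support of `Δ` = `[[3, 4, 10], [13, 1, 17], [401, 1, 1]]` as `(q, v_q N, v_q Δ)`, Kraus prime by prime (kernel). [cite: SilvermanAEC2009, VII.1 Remark 1.1] [cite: Kraus1989, Prop. 1 and Prop. 2] -/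
theorem isGloballyMinimal_w422253b1 : (⟨1, -1, 0, -240106722, -1588926190123⟩ : WeierstrassCurve ℚ).IsGloballyMinimal :=
  X11b.isGloballyMinimal_of_krausCriterion_support 1 (-1) 0 (-240106722) (-1588926190123)
    [(3, 4, 10), (13, 1, 17), (401, 1, 1)]
    (by intro t ht; simp only [List.mem_cons, List.not_mem_nil, or_false] at ht; rcases ht with rfl | rfl | rfl <;> norm_num)
    (by decide +kernel) (by decide +kernel)

/-- **`ρ̄_{E,3}` ONTO for `E = 422253b1`** (kernel): irreducible by `ℓ₁ = 11` (`#Ẽ(𝔽_{11}) = 7`, `X² − 5X + ℓ₁` has no root mod 3); order-3 element by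
`ℓ₂ = 31` (`#Ẽ(𝔽_{31}) = 30`, `ℓ₂ ≡ 1`, `a = 2 ≡ 2 (mod 3)`, `9 ∤ #Ẽ`) — `hasSurjectiveModNGaloisRep_of_intModel_of_irr_of_order`. [cite: Serre1972, §2.4 Prop. 15, §2.8 Prop. 19] -/
theorem surj_w422253b1_3 : (⟨1, -1, 0, -240106722, -1588926190123⟩ : WeierstrassCurve ℚ).HasSurjectiveModNGaloisRep 3 := by
  haveI := isElliptic_w422253b1
  haveI := isGloballyMinimal_w422253b1
  haveI : Fact (Nat.Prime 11) := ⟨by norm_num⟩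
  haveI : Fact (Nat.Prime 31) := ⟨by norm_num⟩
  have hI : integralModelInt (⟨1, -1, 0, -240106722, -1588926190123⟩ : WeierstrassCurve ℚ) = (⟨1, -1, 0, -240106722, -1588926190123⟩ : WeierstrassCurve ℤ) :=
    integralModelInt_eq_of_map_eq _ (map_mk_int 1 (-1) 0 (-240106722) (-1588926190123))
  have hc₁ : Nat.card ((((⟨1, -1, 0, -240106722, -1588926190123⟩ : WeierstrassCurve ℤ)).map (Int.castRingHom (ZMod 11))).toAffine.Point) = 7 := by
    have h := natCard_point_eq_countPoints 1 (-1) 0 (-240106722) (-1588926190123) 11 (by norm_num) (by decide +kernel)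
    have h' : countPoints [1, -1, 0, -240106722, -1588926190123] 11 = 7 := countPoints_eq_of_fast (by decide +kernel)
    exact_mod_cast h.trans h'
  have hc₂ : Nat.card ((((⟨1, -1, 0, -240106722, -1588926190123⟩ : WeierstrassCurve ℤ)).map (Int.castRingHom (ZMod 31))).toAffine.Point) = 30 := by
    have h := natCard_point_eq_countPoints 1 (-1) 0 (-240106722) (-1588926190123) 31 (by norm_num) (by decide +kernel)
    have h' : countPoints [1, -1, 0, -240106722, -1588926190123] 31 = 30 := countPoints_eq_of_fast (by decide +kernel)
    exact_mod_cast h.trans h'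
  exact hasSurjectiveModNGaloisRep_of_intModel_of_irr_of_order hI 3 11 31 (by norm_num) (by norm_num) (by decide +kernel)
    (by decide +kernel) hc₁ hc₂ (by decide) (by decide) (by decide) (by decide)

/-- **`BSD(E,3)` for the DEEP class `E = 422253b1`** (`#Ш_an = 81`): LOWER half = bsd-potss K9's second-descent record `K9Desc3.lower3_deep_422253b1` (deep witness
`x, y ∈ Ш(E)`, `ord x = 9`, `3y = 0`, `y ∉ ℤx` ⟹ `81 ∣ #Ш`; evidence quoted THERE: cc-eng-4 B-1 second `3`-descent, two engines, XVERIFY:PASS) with `W₀ := W`;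
UPPER half = this seat's `missingUpperBoundAt_three_of_x4Cert_tamLocal` (p529837) (Kato 14.5 (3), A161′) — `ρ̄_{E,3}` onto, `Addv W 3`, irreducibility and the `j`-witness
`q = 13` (`v_q(c₄) = 0`, `v_q(Δ) = 17`, `ord_q j = -17`) IN THE KERNEL; displayed: register facts, `hr`/`hs`/`hv` (`#Ш_an = 81`, `ord₃ = 4`), K9's deep witness
`hx`/`h3y`/`hy`, `htam : ord₃ ∏ c_ℓ = v₃(c₃)` (DATA: Cremona `∏ c_ℓ = 3` ∥ Tate at `3`: Kodaira IV*, `c₃ = 3`; so `1 = 1`). Per class (single member); nothing booked. [cite: Kato2004Asterisque, Thm. 14.5 (3) (p. 236), Thm. 17.4 (3) (p. 273)] [cite: Delbourgo1998, Prop. 4 (p. 144)] [cite: Creutz2014, Thm. 7.2] [cite: SilvermanAEC2009, Thm. X.4.14 and VII.1 Remark 1.1] [cite: Miller2011LMS, §1 and Def. 1.1] -/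
theorem bsdp3_deep_422253b1
    (hKato : Kato2004.rankZero_padicValNat_sha_le_sub_localTamagawa_of_additive_potGood_of_imageContainsSL2_maninFree)
    (hDel : Delbourgo1998.prop4_rankZero_pow_dvd_constantCoeff)
    (hGZK : rank_eq_analyticRank_of_analyticRank_le_one) (hmod : hasEntireLFunction_rat)
    (hmodD : nonempty_modularParametrizationData)
    (hKatoω : Wuthrich2014.kato_minusEigenCharIdeal_dvd_cyclotomicThree_of_surjective)
    (hCT : exists_casselsTate_pairing (K := ℚ)) (hCassels : bsdRHS_eq_of_isIsogenous)
    {W : WeierstrassCurve ℚ} [W.IsElliptic] [W.IsGloballyMinimal] (hWeq : W = ⟨1, -1, 0, -240106722, -1588926190123⟩)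
    (hr : W.analyticRank = 0) {s : ℚ} (hs : shaAn W = (s : ℂ)) (hv : padicValRat 3 s ≤ 4)
    {x y : W.sha} (hx : addOrderOf x = 3 ^ 2) (h3y : 3 • y = 0) (hy : y ∉ AddSubgroup.zmultiples x)
    (htam : padicValNat 3 W.tamagawaProduct = padicValNat 3 ((W.baseChange ℚ_[3]).localTamagawaNumber ℤ_[3])) :
    BSDp W 3 := by
  haveI : Fact (Nat.Prime 3) := ⟨Nat.prime_three⟩
  haveI : Fact (Nat.Prime 13) := ⟨by norm_num⟩
  have hsurj : Surj W 3 := by rw [hWeq]; exact surj_w422253b1_3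
  have hIW : integralModelInt W = (⟨1, -1, 0, -240106722, -1588926190123⟩ : WeierstrassCurve ℤ) :=
    integralModelInt_eq_of_map_eq _ (by rw [hWeq]; ext <;> simp [WeierstrassCurve.map])
  have hadd : Addv W 3 := Additive.addv_of_intModel hIW 3 (by decide +kernel) (by decide +kernel)
  have hX : ClassX4 W 3 := ⟨by norm_num, hadd, hasIrreducibleModPGaloisRep_of_hasSurjectiveModNGaloisRep W 3 hsurj⟩
  have hcert : padicValRat 3 W.j < 0 ∨
      (∃ q : ℕ, q.Prime ∧ q ≠ 3 ∧ padicValRat q W.j < 0 ∧ ¬ (3 : ℤ) ∣ padicValRat q W.j) ∨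
        W.HasSurjectiveModNGaloisRep 9 :=
    Or.inr (Or.inl (jWitness_three_of_intModel hIW 13 (by norm_num) 0 17 (by decide +kernel) (by decide +kernel)
      (by decide +kernel) (by decide +kernel) (by norm_num) (by norm_num)))
  have hlow : MissingLowerBoundAt W 3 :=
    K9Desc3.lower3_deep_422253b1 hCT hCassels hGZK hmod W hWeq hr hs hv hx h3y hy W (WeierstrassCurve.isIsogenous_self W)
  exact bsdp_of_missingPPartAt W 3 hGZK (by rw [hr]; exact zero_le_one)
    (missingPPartAt_of_lower_of_upper W 3 hlow
      (missingUpperBoundAt_three_of_x4Cert_tamLocal W hKato hDel hGZK hmod hmodD hKatoω hr hX hsurj hcert htam))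

end Summit.BirchSwinnertonDyer.BirchSwinnertonDyer.Theorems.AdditiveBranchIMCGordTwoRankZeroDesc3

end
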